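import Mathlib
import HarnessLib
import HarnessLib.Audit
import Summits.CriticalPhenomena.PercolationContinuityZ3.Theorems.PercNearOneGluingNoHeavyLowerTailHexMSMatchSym

/-!
# (MATCH) reduces to SATURATED instances: the saturation reduction (hp-7 gen 71)

Support file for crux `stmt-CriticalPhenomena-4575` (route `PercNearOneGluingNoHeavy`), hull-port seat `prim-hp-7` (generation 71);
`--supports stmt-CriticalPhenomena-4575`.  No `sorry`.  Memo: `run/shared/lean/prim/prim-hp-7/FROM-prim-hp-7-g71-SATURATION.md`.

Vocabulary of `…HexMSMatch` / `…HexMSMatchSym`: antipodal instance `(U, 𝒟, x)`, `dead`, `farProducts`, `candidates`, Conjecture (MATCH)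
`MatchHall U 𝒟 x` = Hall's condition `#A ≤ #N(A)` (`N(A) = ⋃_{a ∈ A} candidates a`) for every family `A` of dead members.

**The reduction.**  For a complement-closed family `A` of dead members put `𝒟' := A ∪ (𝒟 ∩ N⁺(A))`, where `N⁺(A) = ⋃_{a ∈ A} farProducts a`
(ALL far meets/joins of members of `A` with members of `𝒟`, members or not).  Then `𝒟' ⊆ 𝒟` is again an antipodal instance
(`restrictTo_compl_mem`), `A` is still dead in it (`subset_dead_restrictTo`, fewer members produce fewer far products), and — the point —
**the candidates of `A` in `𝒟'` are candidates of `A` in `𝒟`** (`biUnion_candidates_restrictTo_subset`): a far product of `a ∈ A` with a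
member of `𝒟'` that is absent from `𝒟'` is absent from `𝒟`, because the members of `𝒟` that are far products of `A` were kept.  Iterating
(strong induction on `#𝒟`) one reaches a fixed point `𝒟' = 𝒟`, i.e. an instance in which EVERY ALIVE MEMBER IS A FAR PRODUCT WITH A DEAD
MEMBER ('saturated', `saturated_of_restrictTo_eq`) and `A` is the WHOLE dead set (`dead_eq_of_restrictTo_eq`).  Hence:

* `card_le_card_biUnion_candidates_of_saturated` — if `#dead ≤ #N(dead)` holds for every saturated SUB-instance `𝒟' ⊆ 𝒟` whose dead set
  satisfies a predicate `Φ`, then `#A ≤ #N(A)` for every complement-closed dead `A ⊆ 𝒟` satisfying `Φ` (e.g. `Φ` = 'labels on two axes').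
* `matchHall_of_saturated` — **(MATCH) for `𝒟` follows from the single inequality `#dead ≤ #N(dead)` on the saturated sub-instances of `𝒟`.**
* `card_le_card_biUnion_farProducts_iff` — on a saturated instance that inequality reads **`#𝒟 ≤ #N⁺(dead 𝒟)`**: 'the far meets and joins
  that involve a DEAD member number at least `#𝒟`' — Conjecture Δ-HEX (`#𝒟 ≤ #symGen`, all far products) with the alive–alive products
  removed, but only asserted for saturated instances.  So the whole tower (MATCH) ⟹ Δ-HEX ⟹ HEX-MS rests on this one inequality.

Census (gen 71, lab/py/saturate.py + kit j249459 `gen71.py`): exhaustive n = 3, random n = 4 (3 184 reductions checked), the reduction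
inequality `#N_{𝒟'}(A) ≤ #N_𝒟(A)` and `#𝒟 ≤ #N⁺(dead)` on all saturated instances met: 0 failures; SAT certificates n ≤ 6 in the job.
-/

namespace Summit.CriticalPhenomena.PercolationContinuityZ3.Theorems

namespace GeneratedDonors

open Finset

variable {α : Type*} [DecidableEq α]

section Monotone

variable {𝒟 ℰ : Finset (Finset α)} {x : Finset α → ZMod 6} {U : Finset α}

/-- `gen` is monotone in the family. -/
theorem gen_mono (h : ℰ ⊆ 𝒟) : gen ℰ x ⊆ gen 𝒟 x := by
  intro d hd
  obtain ⟨a, ha, b, hb, hc, rfl⟩ := mem_gen.mp hd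
  exact mem_gen.mpr ⟨a, h ha, b, h hb, hc, rfl⟩

/-- `symGen` is monotone in the family. -/
theorem symGen_mono (h : ℰ ⊆ 𝒟) : symGen U ℰ x ⊆ symGen U 𝒟 x := by
  unfold symGen
  exact union_subset_union (gen_mono h) (image_subset_image (gen_mono h))

/-- `farProducts` is monotone in the family of partners. -/
theorem farProducts_mono (h : ℰ ⊆ 𝒟) (s : Finset α) : farProducts ℰ x s ⊆ farProducts 𝒟 x s := by
  intro p hp
  obtain ⟨d, hd, hfar, hp⟩ := mem_farProducts.mp hp
  exact mem_farProducts.mpr ⟨d, h hd, hfar, hp⟩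

/-- A member of a sub-family that is dead in the big family is dead in the sub-family. -/
theorem mem_dead_of_subset (h : ℰ ⊆ 𝒟) {s : Finset α} (hsE : s ∈ ℰ) (hs : s ∈ dead U 𝒟 x) : s ∈ dead U ℰ x := by
  unfold dead at hs ⊢
  rw [mem_filter] at hs ⊢
  exact ⟨hsE, fun h' => hs.2 (symGen_mono h h')⟩

end Monotone

section Saturation

variable (U : Finset α) (𝒟 : Finset (Finset α)) (x : Finset α → ZMod 6)

/-- All far products (members or not) with a factor in `A`: `N⁺(A)`. -/
def farNbhd (A : Finset (Finset α)) : Finset (Finset α) := A.biUnion (farProducts 𝒟 x)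

/-- The restriction of the instance to `A` and those members that are far products of `A`: `𝒟' = A ∪ (𝒟 ∩ N⁺(A))`. -/
def restrictTo (A : Finset (Finset α)) : Finset (Finset α) := A ∪ 𝒟.filter fun d => d ∈ farNbhd 𝒟 x A

variable {U 𝒟 x}

/-- Membership in `farNbhd`. -/
theorem mem_farNbhd {A : Finset (Finset α)} {p : Finset α} :
    p ∈ farNbhd 𝒟 x A ↔ ∃ a ∈ A, p ∈ farProducts 𝒟 x a := by
  unfold farNbhd; rw [mem_biUnion]

/-- Membership in `restrictTo`. -/
theorem mem_restrictTo {A : Finset (Finset α)} {d : Finset α} :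
    d ∈ restrictTo 𝒟 x A ↔ d ∈ A ∨ (d ∈ 𝒟 ∧ d ∈ farNbhd 𝒟 x A) := by
  unfold restrictTo; rw [mem_union, mem_filter]

/-- The restriction is a sub-family. -/
theorem restrictTo_subset {A : Finset (Finset α)} (hA : A ⊆ dead U 𝒟 x) : restrictTo 𝒟 x A ⊆ 𝒟 := by
  intro d hd
  rcases mem_restrictTo.mp hd with h | h
  · exact (mem_filter.mp (show d ∈ dead U 𝒟 x from hA h)).1
  · exact h.1

/-- `N(A) = N⁺(A) \ 𝒟`. -/
theorem biUnion_candidates_eq (A : Finset (Finset α)) :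
    A.biUnion (candidates 𝒟 x) = farNbhd 𝒟 x A \ 𝒟 := by
  ext p
  simp only [mem_biUnion, mem_sdiff, mem_farNbhd, candidates]
  constructor
  · rintro ⟨a, ha, hp, hpD⟩; exact ⟨⟨a, ha, hp⟩, hpD⟩
  · rintro ⟨⟨a, ha, hp⟩, hpD⟩; exact ⟨a, ha, hp, hpD⟩

/-- The restriction is closed under complementation (for complement-closed dead `A`). -/
theorem restrictTo_compl_mem (hU : ∀ a ∈ 𝒟, a ⊆ U) (hco : ∀ a ∈ 𝒟, U \ a ∈ 𝒟)
    (hanti : ∀ a ∈ 𝒟, x (U \ a) = x a + 3) {A : Finset (Finset α)} (hA : A ⊆ dead U 𝒟 x)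
    (hAco : ∀ a ∈ A, U \ a ∈ A) {d : Finset α} (hd : d ∈ restrictTo 𝒟 x A) : U \ d ∈ restrictTo 𝒟 x A := by
  rw [mem_restrictTo] at hd ⊢
  rcases hd with h | ⟨hdD, hdN⟩
  · exact Or.inl (hAco d h)
  · refine Or.inr ⟨hco d hdD, ?_⟩
    obtain ⟨a, ha, hp⟩ := mem_farNbhd.mp hdN
    have haD : a ∈ 𝒟 := (mem_filter.mp (show a ∈ dead U 𝒟 x from hA ha)).1
    refine mem_farNbhd.mpr ⟨U \ a, hAco a ha, ?_⟩
    rw [farProducts_compl hU hco hanti haD]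
    exact mem_image_of_mem _ hp

/-- `A` stays dead in the restriction. -/
theorem subset_dead_restrictTo {A : Finset (Finset α)} (hA : A ⊆ dead U 𝒟 x) : A ⊆ dead U (restrictTo 𝒟 x A) x :=
  fun _ ha => mem_dead_of_subset (restrictTo_subset hA) (mem_restrictTo.mpr (Or.inl ha)) (hA ha)

/-- **Key step: the candidates of `A` in the restriction are candidates of `A` in `𝒟`.** -/
theorem biUnion_candidates_restrictTo_subset {A : Finset (Finset α)} (hA : A ⊆ dead U 𝒟 x) :
    A.biUnion (candidates (restrictTo 𝒟 x A) x) ⊆ A.biUnion (candidates 𝒟 x) := by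
  intro p hp
  obtain ⟨a, ha, hpa⟩ := mem_biUnion.mp hp
  unfold candidates at hpa
  rw [mem_sdiff] at hpa
  obtain ⟨hfp, hnot⟩ := hpa
  have hfp' : p ∈ farProducts 𝒟 x a := farProducts_mono (restrictTo_subset hA) a hfp
  refine mem_biUnion.mpr ⟨a, ha, ?_⟩
  unfold candidates
  rw [mem_sdiff]
  refine ⟨hfp', fun hpD => hnot ?_⟩
  exact mem_restrictTo.mpr (Or.inr ⟨hpD, mem_farNbhd.mpr ⟨a, ha, hfp'⟩⟩)

/-- **At a fixed point of the restriction, `A` is the whole dead set.** -/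
theorem dead_eq_of_restrictTo_eq (hU : ∀ a ∈ 𝒟, a ⊆ U) (hco : ∀ a ∈ 𝒟, U \ a ∈ 𝒟)
    (hanti : ∀ a ∈ 𝒟, x (U \ a) = x a + 3) {A : Finset (Finset α)} (hA : A ⊆ dead U 𝒟 x)
    (hfix : restrictTo 𝒟 x A = 𝒟) : dead U 𝒟 x = A := by
  refine Subset.antisymm ?_ hA
  intro d hd
  have hdD : d ∈ 𝒟 := (mem_filter.mp hd).1
  rw [← hfix, mem_restrictTo] at hdD
  rcases hdD with h | ⟨hdD, hdN⟩
  · exact h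
  · exfalso
    obtain ⟨a, ha, hp⟩ := mem_farNbhd.mp hdN
    have haD : a ∈ 𝒟 := (mem_filter.mp (show a ∈ dead U 𝒟 x from hA ha)).1
    exact (mem_filter.mp hd).2 (farProducts_subset_symGen hU hco hanti haD hp)

/-- **At a fixed point of the restriction, the instance is saturated.** -/
theorem saturated_of_restrictTo_eq (hU : ∀ a ∈ 𝒟, a ⊆ U) (hco : ∀ a ∈ 𝒟, U \ a ∈ 𝒟)
    (hanti : ∀ a ∈ 𝒟, x (U \ a) = x a + 3) {A : Finset (Finset α)} (hA : A ⊆ dead U 𝒟 x)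
    (hfix : restrictTo 𝒟 x A = 𝒟) :
    ∀ d ∈ 𝒟, d ∉ dead U 𝒟 x → d ∈ farNbhd 𝒟 x (dead U 𝒟 x) := by
  intro d hdD hndead
  rw [dead_eq_of_restrictTo_eq hU hco hanti hA hfix] at hndead ⊢
  have h := hdD
  rw [← hfix, mem_restrictTo] at h
  rcases h with h | ⟨-, hdN⟩
  · exact absurd h hndead
  · exact hdN

/-- **The saturation reduction.**  Let `Φ` be any predicate on families (e.g. 'labels on two axes').  If for every complement-closed
SATURATED sub-instance `ℰ ⊆ 𝒟` whose dead set satisfies `Φ` one has `#dead ≤ #N(dead)`, then Hall's condition `#A ≤ #N(A)` holds in `𝒟`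
for every complement-closed family `A` of dead members satisfying `Φ`. -/
theorem card_le_card_biUnion_candidates_of_saturated (hU : ∀ a ∈ 𝒟, a ⊆ U) (hco : ∀ a ∈ 𝒟, U \ a ∈ 𝒟)
    (hanti : ∀ a ∈ 𝒟, x (U \ a) = x a + 3) (Φ : Finset (Finset α) → Prop)
    (hsat : ∀ ℰ ⊆ 𝒟, (∀ a ∈ ℰ, U \ a ∈ ℰ) → (∀ d ∈ ℰ, d ∉ dead U ℰ x → d ∈ farNbhd ℰ x (dead U ℰ x)) → Φ (dead U ℰ x) →
      #(dead U ℰ x) ≤ #((dead U ℰ x).biUnion (candidates ℰ x)))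
    {A : Finset (Finset α)} (hA : A ⊆ dead U 𝒟 x) (hAco : ∀ a ∈ A, U \ a ∈ A) (hΦ : Φ A) :
    #A ≤ #(A.biUnion (candidates 𝒟 x)) := by
  -- strong induction on the size of the instance, over all complement-closed sub-instances ℰ ⊆ 𝒟 in which A is dead
  suffices key : ∀ (k : ℕ) (ℰ : Finset (Finset α)), #ℰ ≤ k → ℰ ⊆ 𝒟 → (∀ a ∈ ℰ, U \ a ∈ ℰ) → A ⊆ dead U ℰ x →
      #A ≤ #(A.biUnion (candidates ℰ x)) from key #𝒟 𝒟 le_rfl subset_rfl hco hA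
  intro k
  induction k with
  | zero =>
    intro ℰ hk _ _ hAℰ
    have hℰ : ℰ = ∅ := card_eq_zero.mp (Nat.le_zero.mp hk)
    have hA0 : A = ∅ := by
      rw [eq_empty_iff_forall_notMem]
      intro a ha
      have := (mem_filter.mp (show a ∈ dead U ℰ x from hAℰ ha)).1
      rw [hℰ] at this; exact notMem_empty a this
    rw [hA0]; simp
  | succ k ih =>
    intro ℰ hk hℰ𝒟 hℰco hAℰ
    have hUℰ : ∀ a ∈ ℰ, a ⊆ U := fun a ha => hU a (hℰ𝒟 ha)
    have hantiℰ : ∀ a ∈ ℰ, x (U \ a) = x a + 3 := fun a ha => hanti a (hℰ𝒟 ha)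
    by_cases hfix : restrictTo ℰ x A = ℰ
    · -- fixed point: ℰ is saturated and A is its dead set
      have hdead : dead U ℰ x = A := dead_eq_of_restrictTo_eq hUℰ hℰco hantiℰ hAℰ hfix
      have h := hsat ℰ hℰ𝒟 hℰco (saturated_of_restrictTo_eq hUℰ hℰco hantiℰ hAℰ hfix) (hdead ▸ hΦ)
      rwa [hdead] at h
    · -- proper restriction: induction hypothesis, then monotonicity of the candidates
      have hsub : restrictTo ℰ x A ⊆ ℰ := restrictTo_subset hAℰ
      have hss : restrictTo ℰ x A ⊂ ℰ := lt_of_le_of_ne hsub hfix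
      have hcard : #(restrictTo ℰ x A) ≤ k := Nat.le_of_lt_succ (lt_of_lt_of_le (card_lt_card hss) hk)
      have h := ih (restrictTo ℰ x A) hcard (hsub.trans hℰ𝒟)
        (fun d hd => restrictTo_compl_mem hUℰ hℰco hantiℰ hAℰ hAco hd) (subset_dead_restrictTo hAℰ)
      exact h.trans (card_le_card (biUnion_candidates_restrictTo_subset hAℰ))

/-- **Two-class version.**  Hall's condition for every complement-closed dead family supported on the two axes `{i, i+3}`,
`{i+1, i+4}` follows from `#dead ≤ #N(dead)` on the saturated sub-instances whose dead set is supported on those two axes. -/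
theorem card_le_card_biUnion_candidates_of_saturated_twoAxes (hU : ∀ a ∈ 𝒟, a ⊆ U) (hco : ∀ a ∈ 𝒟, U \ a ∈ 𝒟)
    (hanti : ∀ a ∈ 𝒟, x (U \ a) = x a + 3) (i : ZMod 6)
    (hsat : ∀ ℰ ⊆ 𝒟, (∀ a ∈ ℰ, U \ a ∈ ℰ) → (∀ d ∈ ℰ, d ∉ dead U ℰ x → d ∈ farNbhd ℰ x (dead U ℰ x)) →
      (∀ a ∈ dead U ℰ x, x a = i ∨ x a = i + 1 ∨ x a = i + 3 ∨ x a = i + 4) →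
      #(dead U ℰ x) ≤ #((dead U ℰ x).biUnion (candidates ℰ x)))
    {A : Finset (Finset α)} (hA : A ⊆ dead U 𝒟 x) (hAco : ∀ a ∈ A, U \ a ∈ A)
    (hlab : ∀ a ∈ A, x a = i ∨ x a = i + 1 ∨ x a = i + 3 ∨ x a = i + 4) :
    #A ≤ #(A.biUnion (candidates 𝒟 x)) :=
  card_le_card_biUnion_candidates_of_saturated hU hco hanti
    (fun B => ∀ a ∈ B, x a = i ∨ x a = i + 1 ∨ x a = i + 3 ∨ x a = i + 4) hsat hA hAco hlab

/-- **(MATCH) follows from `#dead ≤ #N(dead)` on the saturated sub-instances.** -/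
theorem matchHall_of_saturated (hU : ∀ a ∈ 𝒟, a ⊆ U) (hco : ∀ a ∈ 𝒟, U \ a ∈ 𝒟)
    (hanti : ∀ a ∈ 𝒟, x (U \ a) = x a + 3)
    (hsat : ∀ ℰ ⊆ 𝒟, (∀ a ∈ ℰ, U \ a ∈ ℰ) → (∀ d ∈ ℰ, d ∉ dead U ℰ x → d ∈ farNbhd ℰ x (dead U ℰ x)) →
      #(dead U ℰ x) ≤ #((dead U ℰ x).biUnion (candidates ℰ x))) :
    MatchHall U 𝒟 x :=
  matchHall_of_complClosed hU hco hanti fun _ hA hAco =>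
    card_le_card_biUnion_candidates_of_saturated hU hco hanti (fun _ => True)
      (fun ℰ hℰ hℰco hs _ => hsat ℰ hℰ hℰco hs) hA hAco trivial

/-- Dead members are not far products: `dead ∩ N⁺(A) = ∅` for `A ⊆ 𝒟`. -/
theorem notMem_farNbhd_of_mem_dead (hU : ∀ a ∈ 𝒟, a ⊆ U) (hco : ∀ a ∈ 𝒟, U \ a ∈ 𝒟)
    (hanti : ∀ a ∈ 𝒟, x (U \ a) = x a + 3) {A : Finset (Finset α)} (hA : A ⊆ 𝒟) {d : Finset α}
    (hd : d ∈ dead U 𝒟 x) : d ∉ farNbhd 𝒟 x A := by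
  intro hdN
  obtain ⟨a, ha, hp⟩ := mem_farNbhd.mp hdN
  exact (mem_filter.mp hd).2 (farProducts_subset_symGen hU hco hanti (hA ha) hp)

/-- **On a saturated instance, `#dead ≤ #N(dead)` is the Δ-HEX-type inequality `#𝒟 ≤ #N⁺(dead)`**: the far meets and joins with a dead
factor number at least `#𝒟` (the alive members are exactly the members inside `N⁺(dead)`). -/
theorem card_le_card_biUnion_farProducts_iff (hU : ∀ a ∈ 𝒟, a ⊆ U) (hco : ∀ a ∈ 𝒟, U \ a ∈ 𝒟)
    (hanti : ∀ a ∈ 𝒟, x (U \ a) = x a + 3) (hsat : (∀ d ∈ 𝒟, d ∉ dead U 𝒟 x → d ∈ farNbhd 𝒟 x (dead U 𝒟 x))) :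
    #(dead U 𝒟 x) ≤ #((dead U 𝒟 x).biUnion (candidates 𝒟 x)) ↔ #𝒟 ≤ #(farNbhd 𝒟 x (dead U 𝒟 x)) := by
  classical
  rw [biUnion_candidates_eq]
  have hdeadD : dead U 𝒟 x ⊆ 𝒟 := filter_subset _ _
  -- the members inside N⁺(dead) are exactly the alive members
  have hinter : farNbhd 𝒟 x (dead U 𝒟 x) ∩ 𝒟 = 𝒟 \ dead U 𝒟 x := by
    ext d
    rw [mem_inter, mem_sdiff]
    constructor
    · rintro ⟨hdN, hdD⟩
      exact ⟨hdD, fun hdead => notMem_farNbhd_of_mem_dead hU hco hanti hdeadD hdead hdN⟩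
    · rintro ⟨hdD, hnd⟩
      exact ⟨hsat d hdD hnd, hdD⟩
  have h1 : #(farNbhd 𝒟 x (dead U 𝒟 x) \ 𝒟) + #(farNbhd 𝒟 x (dead U 𝒟 x) ∩ 𝒟) = #(farNbhd 𝒟 x (dead U 𝒟 x)) :=
    card_sdiff_add_card_inter _ _
  have h2 : #(𝒟 \ dead U 𝒟 x) + #(dead U 𝒟 x) = #𝒟 := card_sdiff_add_card_eq_card hdeadD
  rw [hinter] at h1
  omega

end Saturation

end GeneratedDonors

end Summit.CriticalPhenomena.PercolationContinuityZ3.Theorems
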